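import Mathlib
import HarnessLib
import Summits.RiemannHypothesis.RiemannHypothesis.Theses.WeilParity
import Summits.RiemannHypothesis.RiemannHypothesis.Theses.GroundBarta
import Summits.RiemannHypothesis.RiemannHypothesis.Theorems.WeilParityEvenWinsBeyondArchSplit
import Summits.RiemannHypothesis.RiemannHypothesis.Theorems.WeilParityEvenWinsBeyondArchFrontier63
import Summits.RiemannHypothesis.RiemannHypothesis.Theorems.WeilGroundStateGroundStateSimpleEvenCellTransfer
import Summits.RiemannHypothesis.RiemannHypothesis.Theorems.WeilGroundStateGroundStateSimpleEvenTwoPrimeWindows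
import Summits.RiemannHypothesis.RiemannHypothesis.Theorems.WeilGroundStateGroundStateSimpleEvenOfNoParityCrossing
import Summits.RiemannHypothesis.RiemannHypothesis.Theorems.WeilGroundStateGroundStateSimpleEvenTrialUpperG
import Summits.RiemannHypothesis.RiemannHypothesis.Theorems.WeilGroundStateGroundStateSimpleEvenOddLowerG64

/-!
# Cruxes `NoParityCrossing` (stmt-RiemannHypothesis-18085), `GroundStateSimpleEven` (stmt-RiemannHypothesis-1526) and
# `EvenWinsBeyondArch` (stmt-RiemannHypothesis-15432; GroundBarta rung 4 = stmt-RiemannHypothesis-18807):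
# the RH-free frontier moves from `63/100` to `16/25`

Support file.  Cell `G₁ = [63/100, 16/25]` of the `{2,3}`-window ladder (item 18085, stub `stub_twoThreeWindowSimpleEven`) is
closed RH-free by the landed cell transfer `GroundStateSimpleEven.weilWindowSimpleEven_on_cell_of_le` from

* the U-side `trialUpperG : ε(63/100) ≤ 21/100000000000` (exact-rational Rayleigh–Ritz, degree-22 windowed polynomial), and
* the L-side `oddLowerG64 : Re Q(g) ≥ 1/1000000000` for odd normalised `g` on `[-16/25, 16/25]` (the kernel-checked two-prime
  odd-sector margin certificate `weilCert23G`, Yoshida moment method, `Literature/…/WeilTwoPrimeOddMarginG*.lean`),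

`21/100000000000 < 1/1000000000`.  Consequences (as in `…Frontier63.lean` / `…TwoPrimeWindows.lean` one cell further):
`WeilWindowSimpleEven a` and the strict parity order `ε_ev(a) < ε_od(a)` on EVERY window `0 < a ≤ 16/25`; item 18085 ↔
"no parity tie beyond `16/25`"; `GroundStateSimpleEven` ↔ the same; `EvenWinsBeyondArch` (WeilParity and the GroundBarta copy)
from "no tie beyond `16/25`".  Mathlib + landed tree files only; no definitions, no named facts, no `sorry`.
-/

noncomputable section

open Set MeasureTheory

-- D-0017: single-problem summit ⇒ namespace `Summit.RiemannHypothesis.RiemannHypothesis.…` by design.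
set_option linter.dupNamespace false

namespace Summit.RiemannHypothesis.RiemannHypothesis.Theorems.EvenWinsBeyondArch

open Literature.NumberTheory.LFunctions
open Summit.RiemannHypothesis.RiemannHypothesis.Theses.WeilParity
open Summit.RiemannHypothesis.RiemannHypothesis.Theses.WeilGroundState

/-! ## Cell `G₁ = [63/100, 16/25]` and the clause up to `16/25` -/

/-- **Cell `G₁`**: `WeilWindowSimpleEven a` for every `63/100 ≤ a ≤ 16/25` (cell transfer with `U = 21/10¹¹ < L = 1/10⁹`). [folklore] -/
theorem weilWindowSimpleEven_on_cell_G1 {a : ℝ} (hlo : (63 / 100 : ℝ) ≤ a) (hhi : a ≤ 16 / 25) :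
    WeilWindowSimpleEven a :=
  GroundStateSimpleEven.weilWindowSimpleEven_on_cell_of_le (b := 63 / 100) (c := 16 / 25)
    (U := 21 / 100000000000) (L := 1 / 1000000000) (by norm_num) (by norm_num)
    Summit.RiemannHypothesis.RiemannHypothesis.Theorems.trialUpperG
    Summit.RiemannHypothesis.RiemannHypothesis.Theorems.oddLowerG64 hlo hhi

/-- **The Connes–van Suijlekom hypothesis on every window `0 < a ≤ 16/25` (RH-free)**: archimedean and one-prime windows,
two-prime cells E, F (`weilWindowSimpleEven_of_le_63_100`) and the new cell `G₁`. [folklore] -/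
theorem weilWindowSimpleEven_of_le_16_25 : ∀ a : ℝ, 0 < a → a ≤ 16 / 25 → WeilWindowSimpleEven a := by
  intro a ha hhi
  rcases le_or_gt a (63 / 100) with hle | hlt
  · exact Summit.RiemannHypothesis.RiemannHypothesis.Theorems.weilWindowSimpleEven_of_le_63_100 a ha hle
  · exact weilWindowSimpleEven_on_cell_G1 hlt.le hhi

/-- **Strict parity order up to `16/25`**: `ε_ev(a) < ε_od(a)` for `0 < a ≤ 16/25`. RH-free. [folklore] -/
theorem weilEvenGroundEnergy_lt_weilOddGroundEnergy_of_le_16_25 {a : ℝ} (ha : 0 < a) (hhi : a ≤ 16 / 25) :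
    weilEvenGroundEnergy a < weilOddGroundEnergy a :=
  (weilWindowSimpleEven_iff_weilEvenGroundEnergy_lt ha).1 (weilWindowSimpleEven_of_le_16_25 a ha hhi)

/-- **Every ground state at every window `0 < a ≤ 16/25` is a.e. even.** [folklore] -/
theorem groundStates_ae_even_of_le_16_25 :
    ∀ a : ℝ, 0 < a → a ≤ 16 / 25 → ∀ u : ℝ → ℂ, IsWeilGroundState a u → u =ᵐ[volume] fun t ↦ u (-t) :=
  fun a ha hhi ↦ (GroundStateSimpleEven.weilWindowSimpleEven_iff_groundStates_ae_even ha).1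
    (weilWindowSimpleEven_of_le_16_25 a ha hhi)

/-! ## The residues after cell `G₁`: no parity tie beyond `16/25` -/

/-- **No tie beyond `16/25` ⟹ `NoParityCrossing`** (item stmt-RiemannHypothesis-18085). [folklore] -/
theorem noParityCrossing_of_beyond_16_25
    (h : ∀ a : ℝ, 16 / 25 < a → weilEvenGroundEnergy a ≠ weilOddGroundEnergy a) : NoParityCrossing := by
  intro a ha
  rcases le_or_gt a (16 / 25) with hle | hlt
  · have ha0 : 0 < a := lt_trans (by positivity) ha
    exact ne_of_lt (weilEvenGroundEnergy_lt_weilOddGroundEnergy_of_le_16_25 ha0 hle)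
  · exact h a hlt

/-- **`NoParityCrossing` ⟹ no tie beyond `16/25`** (trivial restriction). [folklore] -/
theorem beyond_16_25_of_noParityCrossing (h : NoParityCrossing) :
    ∀ a : ℝ, 16 / 25 < a → weilEvenGroundEnergy a ≠ weilOddGroundEnergy a := by
  intro a ha
  have hl3 := Real.log_three_lt_d9
  exact h a (by linarith)

/-- **Item 18085 after cell `G₁`: `NoParityCrossing` ↔ no parity tie beyond `16/25`.** [folklore] -/
theorem noParityCrossing_iff_beyond_16_25 :
    NoParityCrossing ↔ ∀ a : ℝ, 16 / 25 < a → weilEvenGroundEnergy a ≠ weilOddGroundEnergy a :=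
  ⟨beyond_16_25_of_noParityCrossing, noParityCrossing_of_beyond_16_25⟩

/-- **`GroundStateSimpleEven` (stmt-RiemannHypothesis-1526) ↔ no parity tie beyond `16/25`.** [folklore] -/
theorem groundStateSimpleEven_iff_noParityCrossingBeyond_16_25 :
    GroundStateSimpleEven ↔ ∀ a : ℝ, 16 / 25 < a → weilEvenGroundEnergy a ≠ weilOddGroundEnergy a :=
  GroundStateSimpleEven.groundStateSimpleEven_iff_noParityCrossing.trans noParityCrossing_iff_beyond_16_25

/-- **The crux `EvenWinsBeyondArch` from "no tie beyond `16/25`"** (landed split glue). [folklore] -/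
theorem evenWinsBeyondArch_of_noTie_beyond_16_25
    (hne : ∀ a : ℝ, 16 / 25 < a → weilEvenGroundEnergy a ≠ weilOddGroundEnergy a) : EvenWinsBeyondArch :=
  evenWinsBeyondArch_of_subs WeilParity.onePrimeWindowSimpleEven_proof (noParityCrossing_of_beyond_16_25 hne)

/-- **What the crux still asserts**: `EvenWinsBeyondArch ↔ ∀ a > 16/25, ε_ev(a) ≤ ε_od(a)`. [folklore] -/
theorem evenWinsBeyondArch_iff_forall_le_beyond_16_25 :
    EvenWinsBeyondArch ↔ ∀ a : ℝ, 16 / 25 < a → weilEvenGroundEnergy a ≤ weilOddGroundEnergy a := by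
  rw [evenWinsBeyondArch_iff_forall_le]
  refine ⟨fun h a ha ↦ h a (lt_trans log_two_half_lt_63 (lt_trans (by norm_num) ha)), fun h a ha ↦ ?_⟩
  rcases le_or_gt a (16 / 25) with hle | hlt
  · exact (weilEvenGroundEnergy_lt_weilOddGroundEnergy_of_le_16_25 (log_two_half_pos.trans ha) hle).le
  · exact h a hlt

/-- **A failure of the crux forces an exact parity tie at some window `a > 16/25`.** [folklore] -/
theorem exists_tie_beyond_16_25_of_not_evenWinsBeyondArch (h : ¬ EvenWinsBeyondArch) :
    ∃ a : ℝ, 16 / 25 < a ∧ weilEvenGroundEnergy a = weilOddGroundEnergy a := by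
  by_contra hne
  push Not at hne
  exact h (evenWinsBeyondArch_of_noTie_beyond_16_25 hne)

end Summit.RiemannHypothesis.RiemannHypothesis.Theorems.EvenWinsBeyondArch

/-! ## The route thesis on every window up to `16/25`, and the GroundBarta transport -/

namespace Summit.RiemannHypothesis.RiemannHypothesis.Theorems.WeilParity

open Literature.NumberTheory.LFunctions

/-- **The even sector wins on every window `0 < a ≤ 16/25`** (RH-free): every odd `L²`-normalised Weil test on `[-a, a]`
is matched up to any `δ > 0` by an even one. [folklore] -/
theorem evenSectorWins_upTo_64 :
    ∀ a : ℝ, 0 < a → a ≤ 16 / 25 → ∀ o : ℝ → ℂ,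
      Literature.NumberTheory.LFunctions.IsWeilTest o → tsupport o ⊆ Set.Icc (-a) a →
      (∀ t, o (-t) = -o t) → ∫ t, ‖o t‖ ^ 2 = (1 : ℝ) → ∀ δ : ℝ, 0 < δ →
        ∃ e : ℝ → ℂ, Literature.NumberTheory.LFunctions.IsWeilTest e ∧ tsupport e ⊆ Set.Icc (-a) a ∧
          (∀ t, e (-t) = e t) ∧ ∫ t, ‖e t‖ ^ 2 = (1 : ℝ) ∧
          (Literature.NumberTheory.LFunctions.weilQuadratic e).re ≤
            (Literature.NumberTheory.LFunctions.weilQuadratic o).re + δ :=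
  fun _ ha hle ↦ evenWinsAt_of_le ha
    (EvenWinsBeyondArch.weilEvenGroundEnergy_lt_weilOddGroundEnergy_of_le_16_25 ha hle).le

end Summit.RiemannHypothesis.RiemannHypothesis.Theorems.WeilParity

namespace Summit.RiemannHypothesis.RiemannHypothesis.Theorems.GroundBarta

open Literature.NumberTheory.LFunctions

/-- **GroundBarta's rung 4 from "no tie beyond `16/25`"** (transport along the `Iff.rfl` copy
`GroundBarta.evenWinsBeyondArch_iff_weilParity`). [folklore] -/
theorem evenWinsBeyondArch_of_noTie_beyond_16_25
    (hne : ∀ a : ℝ, 16 / 25 < a → weilEvenGroundEnergy a ≠ weilOddGroundEnergy a) :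
    Summit.RiemannHypothesis.RiemannHypothesis.Theses.GroundBarta.EvenWinsBeyondArch :=
  evenWinsBeyondArch_iff_weilParity.2 (EvenWinsBeyondArch.evenWinsBeyondArch_of_noTie_beyond_16_25 hne)

/-- **What GroundBarta's rung 4 still asserts**: `↔ ∀ a > 16/25, ε_ev(a) ≤ ε_od(a)`. [folklore] -/
theorem evenWinsBeyondArch_iff_forall_le_beyond_16_25 :
    Summit.RiemannHypothesis.RiemannHypothesis.Theses.GroundBarta.EvenWinsBeyondArch ↔
      ∀ a : ℝ, 16 / 25 < a → weilEvenGroundEnergy a ≤ weilOddGroundEnergy a :=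
  evenWinsBeyondArch_iff_weilParity.trans EvenWinsBeyondArch.evenWinsBeyondArch_iff_forall_le_beyond_16_25

end Summit.RiemannHypothesis.RiemannHypothesis.Theorems.GroundBarta

end
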